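import Literature.NumberTheory.LFunctions.GL2CentralValueBridge
import Literature.NumberTheory.EllipticCurves.PAdicLFunctionNonvanishingProofs
import Literature.NumberTheory.EllipticCurves.CuspFormLFunctionNewformFrickeProofs
import HarnessLib

/-!
# The exact two-sided formula for the central value `L(½, f)` of a weight-2 newform on `Γ₀(N)`
# (Hecke's splitting of the Mellin integral; the "approximate functional equation" with no error)

Topic `Literature/NumberTheory/LFunctions` (cell landau-siegel / ls-inputs, input I2 =
`bettin2017_theorem11_primeLevel`, line `hecke_afe_petersson`, stub S1).

For `f ∈ S_2(Γ₀(N))` a newform with Fricke eigenvalue `ε_f = frickeEigenvalue f` (`w_N f = ε_f f`,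
`ε_f = ±1`, Atkin–Lehner 1970 Thm. 3 — the tree's `IsNewform0.frickeInvolution_eq_smul_holds`) and
every height `y > 0`,

  `L(½, f) = D_f(y) − ε_f · D_f(1/(N y))`,   `D_f(y) = Σ_{n ≥ 1} a_f(n) e^{−2πny}/n`

(`D_f = dampedTwist f 1`, `L(½, f) = IwaniecSarnak.centralValue f`, the central value of record in
the analytic normalisation, `= L^*(f, 1)` classically). This is the `u/m = 0/1` case of the tree's
two-sided modular-symbol series `modularSymbol_eq_rayTail_sub` (Cremona 1997 §2.10; Rohrlich 1984
§2) combined with `{∞, 0}_f = L(f, 1)` (`modularSymbol_zero_eq_holds`, Manin 1972) and the bridge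
`IwaniecSarnak.centralValue f = GL2Family.cuspFormLStar f 1` (`GL2Family.centralValue_eq`). In the
proof of Bettin 2017, Thm. 1.1 (prime level, weight 2) it replaces the one-sided smoothed
approximate functional equation of his Lemma 2.1: it is exact, holds at every height `y`, and its
dual piece carries the explicit factor `ε_f`. Everything here is proved; no definition, no named
fact.

## References
* [Bettin2017] S. Bettin, Funct. Approx. Comment. Math. 57 (2017), Lemma 2.1 (the role played).
* [CremonaAlgorithms1997] J. E. Cremona, *Algorithms for Modular Elliptic Curves*, §2.8, §2.10–2.11.
* [AtkinLehner1970] A. O. L. Atkin, J. Lehner, Math. Ann. 185 (1970), Thm. 3.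
-/

noncomputable section

open scoped Real
open Complex CongruenceSubgroup
open Literature.NumberTheory.EllipticCurves.ModularForms

namespace Literature.NumberTheory.LFunctions.Bettin2017

variable {N : ℕ} [NeZero N]

omit [NeZero N] in
/-- The damped additive twist at the cusp `0` is the plain damped sum:
`T_f(0, y) = D_f(1, y) = Σ a_f(n) e^{−2πny}/n`. [cite: CremonaAlgorithms1997, §2.10 (2.10.3)] -/
theorem rayTail_zero (f : CuspForm (Gamma0 N) 2) (y : ℝ) :
    rayTail f 0 y = dampedTwist f (fun _ ↦ 1) y := by
  unfold rayTail
  congr 1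
  funext n
  simp

/-- **`{∞, 0}_f = L(½, f)`**: the modular symbol at `0` is the central value of record
(`IwaniecSarnak.centralValue f = L^*(f, 1)`, weight `2`). [cite: Manin1972, Thm. 1.3 proof] -/
theorem modularSymbol_zero_eq_centralValue (f : CuspForm (Gamma0 N) 2) :
    modularSymbol f 0 = IwaniecSarnak.centralValue f := by
  rw [GL2Family.centralValue_eq, GL2Family.centralValue]
  have h := modularSymbol_zero_eq_holds f (L := GL2Family.cuspFormLStar f)
    (GL2Family.differentiable_cuspFormLStar f) (fun s hs ↦
      GL2Family.cuspFormLStar_eq_cuspFormLSeries_gamma0 f (by push_cast; linarith))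
  rw [h]
  norm_num

/-- **The exact two-sided formula for `L(½, f)`** (weight `2`, `f` a newform on `Γ₀(N)`): for every
`y > 0`, `L(½, f) = D_f(y) − ε_f D_f(1/(Ny))` with `D_f(y) = Σ_{n≥1} a_f(n) e^{−2πny}/n`
(`dampedTwist f 1 y`) and `ε_f = frickeEigenvalue f` — Hecke's splitting of `∫_0^∞ f(it) dt` at
height `y` and the flip `t ↦ 1/(Nt)` (`modularSymbol_eq_rayTail_sub` at the cusp `0/1`); the exact
substitute for Bettin's Lemma 2.1 at `α = 0`, `χ = 1`. [cite: Bettin2017, Lemma 2.1]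
[cite: CremonaAlgorithms1997, §2.10–§2.11] -/
theorem centralValue_eq_dampedTwist_sub (f : CuspForm (Gamma0 N) 2) (hf : f ∈ newforms0 N 2)
    {y : ℝ} (hy : 0 < y) :
    IwaniecSarnak.centralValue f =
      dampedTwist f (fun _ ↦ 1) y -
        frickeEigenvalue f * dampedTwist f (fun _ ↦ 1) (1 / ((N : ℝ) * y)) := by
  have hW : IsFrickeEigen N f (frickeEigenvalue f) :=
    isFrickeEigen_of_frickeInvolution_eq_smul N (IsNewform0.frickeInvolution_eq_smul_holds hf)
  have h := modularSymbol_eq_rayTail_sub f hW (m := 1) one_pos (a := 1) (u := 0) (v := 0)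
    (by norm_num) hy
  simp only [Int.cast_zero, Nat.cast_one, div_one, one_pow, mul_one] at h
  rw [← modularSymbol_zero_eq_centralValue, h, rayTail_zero, rayTail_zero]

/-- The registered stub S1 of the I2 skeleton `hecke_afe_petersson`, in its registered quantifier
shape. [cite: Bettin2017, Lemma 2.1] -/
theorem centralValue_eq_dampedTwist_sub_all :
    ∀ (N : ℕ) [NeZero N] (f : CuspForm (Gamma0 N) 2), f ∈ newforms0 N 2 → ∀ y : ℝ, 0 < y →
      IwaniecSarnak.centralValue f =
        dampedTwist f (fun _ ↦ 1) y -
          frickeEigenvalue f * dampedTwist f (fun _ ↦ 1) (1 / ((N : ℝ) * y)) :=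
  fun _ _ f hf _ hy ↦ centralValue_eq_dampedTwist_sub f hf hy

end Literature.NumberTheory.LFunctions.Bettin2017

end
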